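import Summits.AtomisticToContinuum.Crystallization.Theorems.FrustratedLawDichotomyStrainedPatchShellWitnessA

/-!
# «ShellWitness» (lens-5 g64, 27623 T-side: exact-riding chart toolkit, loose bridges (R12)/(N13), ShellFit/ShellRigid13 leaves + tight bridge, wall arithmetic at τ = 1/80) — part B (sequel of `…FrustratedLawDichotomyStrainedPatchShellWitnessA`)

Split for the 400-line cap by the landing lane (hand-2 g30); the module docstring of part A describes the whole node.  Same namespace; all FQNs unchanged.
0 sorry; standard axioms.
-/

noncomputable section

namespace Summit.AtomisticToContinuum.Crystallization.Theorems.FrustratedLawDichotomyStrainedPatchShellWitness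

open scoped BigOperators Classical RealInnerProductSpace
open Literature.Geometry.DiscreteGeometry (fccKissingPattern hcpKissingPattern card_fccKissingPattern card_hcpKissingPattern
  norm_eq_one_of_mem_fccKissingPattern norm_eq_one_of_mem_hcpKissingPattern one_le_dist_of_mem_fccKissingPattern one_le_dist_of_mem_hcpKissingPattern)
open Summit.AtomisticToContinuum.Crystallization.Theorems.FrustratedLawDichotomyPeriodicBlockFlags (goodAtScale_mono)
open Summit.AtomisticToContinuum.Crystallization.Theorems.FrustratedLawDichotomyRangeCut (Sep)
open Summit.AtomisticToContinuum.Crystallization.Theorems.FrustratedLawDichotomyMotifLemmas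
open Summit.AtomisticToContinuum.Crystallization.Theorems.FrustratedLawDichotomyAveragingCut
open Summit.AtomisticToContinuum.Crystallization.Theorems.FrustratedLawDichotomyAveragingRuleCap
open Summit.AtomisticToContinuum.Crystallization.Theorems.FrustratedLawDichotomyAveragingRuleTightFree
open Summit.AtomisticToContinuum.Crystallization.Theorems.FrustratedLawDichotomyExemptDoor (SitePred)
open Summit.AtomisticToContinuum.Crystallization.Theorems.FrustratedLawDichotomyExemptAbsorption
open Summit.AtomisticToContinuum.Crystallization.Theorems.FrustratedLawDichotomyExemptAbsorptionRecord
open Summit.AtomisticToContinuum.Crystallization.Theorems.FrustratedLawDichotomyCollarCensus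
open Summit.AtomisticToContinuum.Crystallization.Theorems.FrustratedLawDichotomyCollarCensusKappa
open Summit.AtomisticToContinuum.Crystallization.Theorems.FrustratedLawDichotomyStrainedPatchHomSplit
open Summit.AtomisticToContinuum.Crystallization.Theorems.FrustratedLawDichotomyStrainedPatchCleanCollar
open Summit.AtomisticToContinuum.Crystallization.Theorems.FrustratedLawDichotomyStrainedPatchHomTube
open Summit.AtomisticToContinuum.Crystallization.Theorems.FrustratedLawDichotomyStrainedPatchHomPolar
open Summit.AtomisticToContinuum.Crystallization.Theorems.FrustratedLawDichotomyStrainedPatchHomIsometry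
open Summit.AtomisticToContinuum.Crystallization.Theorems.FrustratedLawDichotomyStrainedPatchHomTubeIso
open Summit.AtomisticToContinuum.Crystallization.Theorems.FrustratedLawDichotomyStrainedPatchPhaseCut
open Summit.AtomisticToContinuum.Crystallization.Theorems.FrustratedLawDichotomyStrainedPatchCoreTube
open Summit.AtomisticToContinuum.Crystallization.Theorems.FrustratedLawDichotomyStrainedPatchCoreTubeRecord
open Summit.AtomisticToContinuum.Crystallization.Theorems.FrustratedLawDichotomyStrainedPatchCoreTubeMilli
open Summit.AtomisticToContinuum.Crystallization.Theorems.FrustratedLawDichotomyStrainedPatchStrainBands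
open Summit.AtomisticToContinuum.Crystallization.Theorems.FrustratedLawDichotomyStrainedPatchChartFamilies
open Summit.AtomisticToContinuum.Crystallization.Theorems.FrustratedLawDichotomyStrainedPatchChartFamiliesBent
open Summit.AtomisticToContinuum.Crystallization.Theorems.FrustratedLawDichotomyStrainedPatchChartFamiliesPinned
open Summit.AtomisticToContinuum.Crystallization.Theorems.FrustratedLawDichotomyStrainedPatchRecutPairs
open Summit.AtomisticToContinuum.Crystallization.Theorems.FrustratedLawDichotomyStrainedPatchRecutKinematics
open Summit.AtomisticToContinuum.Crystallization.Theorems.FrustratedLawDichotomyStrainedPatchWindowFamilies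
open Summit.AtomisticToContinuum.Crystallization.Theorems.FrustratedLawDichotomyStrainedPatchHostCells
open Summit.AtomisticToContinuum.Crystallization.Theorems.FrustratedLawDichotomyStrainedPatchGaugeCells

/-! ## §3. The DEAD-lo side: the complete-distance rigidity LEAVES — (K13-inst) `ShellFit` per reference shell, (K13) `ShellRigid13` uniform — and the tight bridge -/

/-- **(K13-inst) `ShellFit P p p₀ ε θ` — the INSTANCE LEAF at one reference shell [ATTACKABLE per cell by validated numerics].**  Every 13-point configuration
`(q₀; q u)` whose `12 + 66` mutual distances are each within `ε` of those of the reference shell `(p₀; p u)` carries an isometric fit of the pattern `P` at ITS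
pinned scale `d'` (the least shell distance) with misfit `≤ θ`, IN THE SAME LABELLING (`A'` ranges over all linear isometries, so the mirror ambiguity of
distance data is harmless).  A closed semialgebraic condition on the 13 reference points alone. -/
def ShellFit {ι : Type*} (P : ι → E3) (p : ι → E3) (p₀ : E3) (ε θ : ℝ) : Prop :=
  ∀ (q : ι → E3) (q₀ : E3) (d' : ℝ),
    (∀ u, |dist (q u) q₀ - dist (p u) p₀| ≤ ε) → (∀ u v, |dist (q u) (q v) - dist (p u) (p v)| ≤ ε) →
    (∀ u, d' ≤ dist (q u) q₀) → (∃ u, dist (q u) q₀ ≤ d') →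
    ∃ A' : E3 →ₗᵢ[ℝ] E3, ∀ u, ‖(q u - q₀) - d' • A' (P u)‖ ≤ θ

/-- **(K13) `ShellRigid13At c P` — UNIFORM COMPLETE-DATA SHELL RIGIDITY of the kissing pattern `P` with constant `c` [LEAF · ATTACKABLE; `c` to be CALIBRATED].**
For every 13-point configuration `(p₀; p u)` carrying a scale-`d` isometric fit of `P` with misfit `≤ η d` (`0 ≤ η ≤ 1/8`, `d` pinned as the least shell
distance) and every data error `0 ≤ ε ≤ d/20`: `ShellFit P p p₀ ε (η d + c ε)`.  Classical (trilateration from a well-conditioned frame of the cuboctahedron /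
anticuboctahedron, then re-fit and re-pin); the CONSTANT is the only content.  Scale-covariant, so `d = 1` w.l.o.g. for whoever proves it. -/
def ShellRigid13At (c : ℝ) {ι : Type*} (P : ι → E3) : Prop :=
  ∀ (p : ι → E3) (p₀ : E3) (d η ε : ℝ) (A : E3 →ₗᵢ[ℝ] E3),
    0 < d → 0 ≤ η → η ≤ 1 / 8 → 0 ≤ ε → 20 * ε ≤ d →
    (∀ u, ‖(p u - p₀) - d • A (P u)‖ ≤ η * d) → (∀ u, d ≤ dist (p u) p₀) → (∃ u, dist (p u) p₀ ≤ d) →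
    ShellFit P p p₀ ε (η * d + c * ε)

/-- **(K13) for both stacking phases: `ShellRigid13 c`.** -/
def ShellRigid13 (c : ℝ) : Prop :=
  ShellRigid13At c (fun u : ↥fccKissingPattern => (u : E3)) ∧ ShellRigid13At c (fun u : ↥hcpKissingPattern => (u : E3))

/-- `ShellFit` is monotone in the misfit budget. [formal bookkeeping] -/
theorem ShellFit.mono {ι : Type*} {P p : ι → E3} {p₀ : E3} {ε θ θ' : ℝ} (h : ShellFit P p p₀ ε θ) (hle : θ ≤ θ') : ShellFit P p p₀ ε θ' := by
  intro q q₀ d' hdev₀ hdev hqpin hqpin'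
  obtain ⟨A', hA'⟩ := h q q₀ d' hdev₀ hdev hqpin hqpin'
  exact ⟨A', fun u => (hA' u).trans hle⟩

/-- `ShellFit` is antitone in the data error. [formal bookkeeping] -/
theorem ShellFit.anti {ι : Type*} {P p : ι → E3} {p₀ : E3} {ε ε' θ : ℝ} (h : ShellFit P p p₀ ε' θ) (hle : ε ≤ ε') : ShellFit P p p₀ ε θ :=
  fun q q₀ d' hdev₀ hdev hqpin hqpin' => h q q₀ d' (fun u => (hdev₀ u).trans hle) (fun u v => (hdev u v).trans hle) hqpin hqpin'

/-- (K13) is monotone in the constant. [formal bookkeeping] -/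
theorem ShellRigid13At.mono {c c' : ℝ} {ι : Type*} {P : ι → E3} (h : ShellRigid13At c P) (hle : c ≤ c') : ShellRigid13At c' P :=
  fun p p₀ d η ε A hd hη hη' hε hεd hfit hpin hpin' =>
    (h p p₀ d η ε A hd hη hη' hε hεd hfit hpin hpin').mono (by nlinarith [mul_le_mul_of_nonneg_right hle hε])

/-- `ShellRigid13.mono`. [formal bookkeeping] -/
theorem ShellRigid13.mono {c c' : ℝ} (h : ShellRigid13 c) (hle : c ≤ c') : ShellRigid13 c' := ⟨h.1.mono hle, h.2.mono hle⟩

/-- Sanity (the leaf is not absurd at zero error): the reference shell itself, re-pinned at its own least distance `d`, passes `ShellFit … 0 θ` for the input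
fit — PROVIDED the data error is `0` AND `q = p`; recorded only to show the hypotheses of (K13) are jointly satisfiable with its conclusion. [formal bookkeeping] -/
theorem shellFit_self_of_fit {ι : Type*} (P : ι → E3) (p : ι → E3) (p₀ : E3) (d η : ℝ) (A : E3 →ₗᵢ[ℝ] E3)
    (hfit : ∀ u, ‖(p u - p₀) - d • A (P u)‖ ≤ η * d) (hpin : ∀ u, d ≤ dist (p u) p₀) (hpin' : ∃ u, dist (p u) p₀ ≤ d) (d' : ℝ)
    (hqpin : ∀ u, d' ≤ dist (p u) p₀) (hqpin' : ∃ u, dist (p u) p₀ ≤ d') : ∃ A' : E3 →ₗᵢ[ℝ] E3, ∀ u, ‖(p u - p₀) - d' • A' (P u)‖ ≤ η * d := by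
  have hd : d' = d := by
    obtain ⟨u, hu⟩ := hpin'
    obtain ⟨v, hv⟩ := hqpin'
    exact le_antisymm ((hqpin u).trans hu) ((hpin v).trans hv)
  exact ⟨A, fun u => by rw [hd]; exact hfit u⟩

section Tight
variable {M₁ : ℕ} {z₁ : Fin M₁ → E3} {c₁ a₁ : Fin M₁} {τ : ℝ}

/-- ★★ **THE TIGHT BRIDGE from the INSTANCE LEAF, one pattern** (DEAD-lo).  Reference side (census data at the site `a₁`): a labelled shell `S : ι → sites ≠ a₁`
of the `6`-ball, pinned at `d₁` (every shell site at distance `≥ d₁`, one at `≤ d₁`), with a clean gap of half-width `g₁` about `13/10·d₁` whose inside consists of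
shell sites, and the instance leaf `ShellFit P (z₁ ∘ S) (z₁ a₁) (2τ) θ`.  MARGINS: (M1) `20 θ < d₁ − 2τ` [misfit `θ` against the new scale `d' ≥ d₁ − 2τ` stays
below `1/20`], (M2) `23τ/5 < g₁` [the gap survives `2τ` on each side and the `13/10`-rescaling], (M3) `d₁ + 2τ ≤ 3/2` [scale cap], (M4) room in the
`63/10`-ball, (M5) `40τ ≤ d₁`.  CONCLUSION: every cluster site charted onto `a₁` at exact riding `(τ,0,0)` carries a `P`-fit with misfit `< 1/20` at scale
`≤ 3/2` — shell `u ↦ z (preimage of S u)`, isometry from the leaf, scale re-pinned in the WHOLE cluster, gap transferred through the chart. [folklore] -/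
theorem fit_twentieth_of_shellFit {ι : Type*} [Fintype ι] {P : ι → E3} (hτ : 0 ≤ τ) {S : ι → Fin M₁} {d₁ g₁ θ : ℝ}
    (hSa : ∀ u, S u ≠ a₁) (hS₆ : ∀ u, dist (z₁ (S u)) (z₁ c₁) ≤ 6) (hθ : ShellFit P (fun u => z₁ (S u)) (z₁ a₁) (2 * τ) θ)
    (hpin₁ : ∀ u, d₁ ≤ dist (z₁ (S u)) (z₁ a₁)) (hpin₁' : ∃ u, dist (z₁ (S u)) (z₁ a₁) ≤ d₁)
    (hgap₁ : ∀ b₁, b₁ ≠ a₁ → dist (z₁ b₁) (z₁ a₁) < 13 / 10 * d₁ + g₁ → dist (z₁ b₁) (z₁ a₁) ≤ 13 / 10 * d₁ - g₁ ∧ ∃ u, S u = b₁)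
    (hM₁ : 20 * θ < d₁ - 2 * τ) (hM₂ : 23 / 5 * τ < g₁) (hM₃ : d₁ + 2 * τ ≤ 3 / 2)
    (hM₄ : dist (z₁ a₁) (z₁ c₁) + 2 * τ + (13 / 10 * (d₁ + 2 * τ) + g₁) ≤ 63 / 10) (hM₅ : 40 * τ ≤ d₁)
    {M : ℕ} {z : Fin M → E3} {c₀ : Fin M} {e' : Fin M → Fin M₁} (hch : Charted z₁ c₁ τ 0 0 M z c₀ e') {a : Fin M}
    (ha : dist (z a) (z c₀) ≤ 63 / 10) (hea : e' a = a₁) : FitAtScale P (1 / 20) (3 / 2) z a := by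
  have hinjz := hch.injective
  have hac : dist (z a) (z c₀) ≤ dist (z₁ a₁) (z₁ c₁) + 2 * τ := by
    have h₁ := hch.centre ha
    rwa [hea] at h₁
  -- the cluster shell: preimages of the reference shell
  choose pre hpre using fun u => hch.cover (hS₆ u)
  have hpa : ∀ u, pre u ≠ a := fun u h => hSa u (by rw [← (hpre u).2, h, hea])
  have hdev₀ : ∀ u, |dist (z (pre u)) (z a) - dist (z₁ (S u)) (z₁ a₁)| ≤ 2 * τ := fun u => by
    have h₁ := hch.dev (hpre u).1 ha
    rwa [(hpre u).2, hea] at h₁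
  have hdev : ∀ u v, |dist (z (pre u)) (z (pre v)) - dist (z₁ (S u)) (z₁ (S v))| ≤ 2 * τ := fun u v => by
    have h₁ := hch.dev (hpre u).1 (hpre v).1
    rwa [(hpre u).2, (hpre v).2] at h₁
  -- the re-pinned scale `d'` = least distance of the cluster shell
  obtain ⟨u₁, hu₁⟩ := hpin₁'
  have hne : (Finset.univ : Finset ι).Nonempty := ⟨u₁, Finset.mem_univ _⟩
  obtain ⟨u₀, -, hu₀⟩ := Finset.exists_min_image Finset.univ (fun u => dist (z (pre u)) (z a)) hne
  have hd'lo : d₁ - 2 * τ ≤ dist (z (pre u₀)) (z a) := by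
    have h₁ := hdev₀ u₀
    have h₂ := hpin₁ u₀
    linarith [(abs_sub_le_iff.1 h₁).2]
  have hd'hi : dist (z (pre u₀)) (z a) ≤ d₁ + 2 * τ := by
    have h₁ := hdev₀ u₁
    have h₂ := hu₀ u₁ (Finset.mem_univ _)
    linarith [(abs_sub_le_iff.1 h₁).1]
  have hd'pos : 0 < dist (z (pre u₀)) (z a) := dist_pos.2 (hinjz.ne (hpa u₀))
  -- the instance leaf
  obtain ⟨A', hA'⟩ := hθ (fun u => z (pre u)) (z a) (dist (z (pre u₀)) (z a)) hdev₀ hdev (fun u => hu₀ u (Finset.mem_univ _)) ⟨u₀, le_rfl⟩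
  -- the new misfit parameter
  have hθ0 : 0 ≤ θ := (norm_nonneg _).trans (hA' u₀)
  have hη'd : θ / dist (z (pre u₀)) (z a) * dist (z (pre u₀)) (z a) = θ := div_mul_cancel₀ _ hd'pos.ne'
  have hη'lt : θ / dist (z (pre u₀)) (z a) < 1 / 20 := by
    refine lt_of_mul_lt_mul_right ?_ hd'pos.le
    rw [hη'd]
    linarith
  refine ⟨dist (z (pre u₀)) (z a), θ / dist (z (pre u₀)) (z a), g₁ - 23 / 5 * τ, A', hd'hi.trans hM₃, fun u => z (pre u),
    hd'pos, by linarith, hη'lt, fun u => ⟨⟨pre u, rfl⟩, ?_⟩, ?_, ⟨z (pre u₀), ⟨pre u₀, rfl⟩, hinjz.ne (hpa u₀), le_rfl⟩, ?_⟩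
  · rw [hη'd]; exact hA' u
  · -- nn pinning of `d'` in the WHOLE cluster: a closer site would chart onto a shell site of the reference (gap), i.e. BE a shell preimage
    rintro s ⟨j, rfl⟩ hja
    have hja' : j ≠ a := fun h => hja (congrArg z h)
    by_contra hlt
    rw [not_le] at hlt
    have hjball : dist (z j) (z c₀) ≤ 63 / 10 := by
      have h₁ := dist_triangle (z j) (z a) (z c₀)
      linarith
    have hej : e' j ≠ a₁ := fun h => hja' (hch.inj hjball ha (h.trans hea.symm))
    have h₁ := hch.dev hjball ha
    rw [hea] at h₁
    have hclose : dist (z₁ (e' j)) (z₁ a₁) < 13 / 10 * d₁ + g₁ := by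
      linarith [(abs_sub_le_iff.1 h₁).2]
    obtain ⟨-, u, hu⟩ := hgap₁ (e' j) hej hclose
    have hju : pre u = j := hch.inj (hpre u).1 hjball (by rw [(hpre u).2, hu])
    have h₂ := hu₀ u (Finset.mem_univ _)
    rw [hju] at h₂
    linarith
  · -- the clean gap, transferred: half-width `g₁ − 23τ/5` below `13/10·d'`
    rintro s ⟨j, rfl⟩ hja hlt
    have hja' : j ≠ a := fun h => hja (congrArg z h)
    have hjball : dist (z j) (z c₀) ≤ 63 / 10 := by
      have h₁ := dist_triangle (z j) (z a) (z c₀)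
      linarith
    have hej : e' j ≠ a₁ := fun h => hja' (hch.inj hjball ha (h.trans hea.symm))
    have h₁ := hch.dev hjball ha
    rw [hea] at h₁
    have hclose : dist (z₁ (e' j)) (z₁ a₁) < 13 / 10 * d₁ + g₁ := by
      linarith [(abs_sub_le_iff.1 h₁).2]
    obtain ⟨hle, u, hu⟩ := hgap₁ (e' j) hej hclose
    have hju : pre u = j := hch.inj (hpre u).1 hjball (by rw [(hpre u).2, hu])
    refine ⟨?_, u, congrArg z hju⟩
    have h₂ := hdev₀ u
    rw [hju, hu] at h₂
    linarith [(abs_sub_le_iff.1 h₂).1]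

/-- ★★ **THE TIGHT BRIDGE from the UNIFORM LEAF (K13), one pattern**: with an isometric fit of the reference shell of misfit `η₁` at the pinned scale `d₁`,
`ShellRigid13At c P` supplies the instance leaf with `θ = η₁ d₁ + c·2τ`; margin (M1) reads `20·(η₁ d₁ + 2cτ) < d₁ − 2τ` ((K13)'s side conditions
`η₁ ≤ 1/8`, `20·2τ ≤ d₁` follow from (M1), (M5)). [folklore] -/
theorem fit_twentieth_of_refShell {ι : Type*} [Fintype ι] {P : ι → E3} {c : ℝ} (hK : ShellRigid13At c P) (hc : 0 ≤ c) (hτ : 0 ≤ τ)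
    {S : ι → Fin M₁} {d₁ η₁ g₁ : ℝ} {A₁ : E3 →ₗᵢ[ℝ] E3} (hSa : ∀ u, S u ≠ a₁) (hS₆ : ∀ u, dist (z₁ (S u)) (z₁ c₁) ≤ 6)
    (hfit₁ : ∀ u, ‖(z₁ (S u) - z₁ a₁) - d₁ • A₁ (P u)‖ ≤ η₁ * d₁) (hη₁ : 0 ≤ η₁)
    (hpin₁ : ∀ u, d₁ ≤ dist (z₁ (S u)) (z₁ a₁)) (hpin₁' : ∃ u, dist (z₁ (S u)) (z₁ a₁) ≤ d₁)
    (hgap₁ : ∀ b₁, b₁ ≠ a₁ → dist (z₁ b₁) (z₁ a₁) < 13 / 10 * d₁ + g₁ → dist (z₁ b₁) (z₁ a₁) ≤ 13 / 10 * d₁ - g₁ ∧ ∃ u, S u = b₁)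
    (hM₁ : 20 * (η₁ * d₁ + c * (2 * τ)) < d₁ - 2 * τ) (hM₂ : 23 / 5 * τ < g₁) (hM₃ : d₁ + 2 * τ ≤ 3 / 2)
    (hM₄ : dist (z₁ a₁) (z₁ c₁) + 2 * τ + (13 / 10 * (d₁ + 2 * τ) + g₁) ≤ 63 / 10) (hM₅ : 40 * τ ≤ d₁)
    {M : ℕ} {z : Fin M → E3} {c₀ : Fin M} {e' : Fin M → Fin M₁} (hch : Charted z₁ c₁ τ 0 0 M z c₀ e') {a : Fin M}
    (ha : dist (z a) (z c₀) ≤ 63 / 10) (hea : e' a = a₁) : FitAtScale P (1 / 20) (3 / 2) z a := by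
  have h2τ : (0 : ℝ) ≤ 2 * τ := by linarith
  have hd₁nn : 0 ≤ d₁ := by linarith
  have hd₁τ : 2 * τ < d₁ := by nlinarith [mul_nonneg hη₁ hd₁nn, mul_nonneg hc h2τ]
  have hd₁ : 0 < d₁ := by linarith
  have hη₁' : η₁ ≤ 1 / 8 := by
    by_contra hlt
    rw [not_le] at hlt
    nlinarith [mul_lt_mul_of_pos_right hlt hd₁, mul_nonneg hc h2τ]
  have hθ : ShellFit P (fun u => z₁ (S u)) (z₁ a₁) (2 * τ) (η₁ * d₁ + c * (2 * τ)) :=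
    hK (fun u => z₁ (S u)) (z₁ a₁) d₁ η₁ (2 * τ) A₁ hd₁ hη₁ hη₁' h2τ (by linarith) hfit₁ hpin₁ hpin₁'
  exact fit_twentieth_of_shellFit hτ hSa hS₆ hθ hpin₁ hpin₁' hgap₁ hM₁ hM₂ hM₃ hM₄ hM₅ hch ha hea

/-- ★★ **DEAD-lo CERTIFICATE from the INSTANCE LEAF, fcc reference shell** ⟹ `TightWitness z₁ c₁ τ 0 0 a₁`. [folklore] -/
theorem tightWitness_of_fccShellFit (hτ : 0 ≤ τ) {S : ↥fccKissingPattern → Fin M₁} {d₁ g₁ θ : ℝ} (hSa : ∀ u, S u ≠ a₁)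
    (hS₆ : ∀ u, dist (z₁ (S u)) (z₁ c₁) ≤ 6) (hθ : ShellFit (fun u : ↥fccKissingPattern => (u : E3)) (fun u => z₁ (S u)) (z₁ a₁) (2 * τ) θ)
    (hpin₁ : ∀ u, d₁ ≤ dist (z₁ (S u)) (z₁ a₁)) (hpin₁' : ∃ u, dist (z₁ (S u)) (z₁ a₁) ≤ d₁)
    (hgap₁ : ∀ b₁, b₁ ≠ a₁ → dist (z₁ b₁) (z₁ a₁) < 13 / 10 * d₁ + g₁ → dist (z₁ b₁) (z₁ a₁) ≤ 13 / 10 * d₁ - g₁ ∧ ∃ u, S u = b₁)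
    (hM₁ : 20 * θ < d₁ - 2 * τ) (hM₂ : 23 / 5 * τ < g₁) (hM₃ : d₁ + 2 * τ ≤ 3 / 2)
    (hM₄ : dist (z₁ a₁) (z₁ c₁) + 2 * τ + (13 / 10 * (d₁ + 2 * τ) + g₁) ≤ 63 / 10) (hM₅ : 40 * τ ≤ d₁) : TightWitness z₁ c₁ τ 0 0 a₁ :=
  fun _ _ _ _ hch _ ha hea =>
    goodAtScale_iff_fcc_or_hcp.2 (Or.inl (fit_twentieth_of_shellFit hτ hSa hS₆ hθ hpin₁ hpin₁' hgap₁ hM₁ hM₂ hM₃ hM₄ hM₅ hch ha hea))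

/-- ★★ **DEAD-lo CERTIFICATE from the INSTANCE LEAF, hcp reference shell** ⟹ `TightWitness z₁ c₁ τ 0 0 a₁`. [folklore] -/
theorem tightWitness_of_hcpShellFit (hτ : 0 ≤ τ) {S : ↥hcpKissingPattern → Fin M₁} {d₁ g₁ θ : ℝ} (hSa : ∀ u, S u ≠ a₁)
    (hS₆ : ∀ u, dist (z₁ (S u)) (z₁ c₁) ≤ 6) (hθ : ShellFit (fun u : ↥hcpKissingPattern => (u : E3)) (fun u => z₁ (S u)) (z₁ a₁) (2 * τ) θ)
    (hpin₁ : ∀ u, d₁ ≤ dist (z₁ (S u)) (z₁ a₁)) (hpin₁' : ∃ u, dist (z₁ (S u)) (z₁ a₁) ≤ d₁)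
    (hgap₁ : ∀ b₁, b₁ ≠ a₁ → dist (z₁ b₁) (z₁ a₁) < 13 / 10 * d₁ + g₁ → dist (z₁ b₁) (z₁ a₁) ≤ 13 / 10 * d₁ - g₁ ∧ ∃ u, S u = b₁)
    (hM₁ : 20 * θ < d₁ - 2 * τ) (hM₂ : 23 / 5 * τ < g₁) (hM₃ : d₁ + 2 * τ ≤ 3 / 2)
    (hM₄ : dist (z₁ a₁) (z₁ c₁) + 2 * τ + (13 / 10 * (d₁ + 2 * τ) + g₁) ≤ 63 / 10) (hM₅ : 40 * τ ≤ d₁) : TightWitness z₁ c₁ τ 0 0 a₁ :=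
  fun _ _ _ _ hch _ ha hea =>
    goodAtScale_iff_fcc_or_hcp.2 (Or.inr (fit_twentieth_of_shellFit hτ hSa hS₆ hθ hpin₁ hpin₁' hgap₁ hM₁ hM₂ hM₃ hM₄ hM₅ hch ha hea))

/-- ★★ **DEAD-lo ⟹ DEAD cell from the INSTANCE LEAF** (fcc shell; the site within `9/2 − 2τ` of the centre, T2). [folklore] -/
theorem deadRef_of_fccShellFit (hτ : 0 ≤ τ) (hr : dist (z₁ a₁) (z₁ c₁) + 2 * τ ≤ 9 / 2) {S : ↥fccKissingPattern → Fin M₁} {d₁ g₁ θ : ℝ}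
    (hSa : ∀ u, S u ≠ a₁) (hS₆ : ∀ u, dist (z₁ (S u)) (z₁ c₁) ≤ 6)
    (hθ : ShellFit (fun u : ↥fccKissingPattern => (u : E3)) (fun u => z₁ (S u)) (z₁ a₁) (2 * τ) θ)
    (hpin₁ : ∀ u, d₁ ≤ dist (z₁ (S u)) (z₁ a₁)) (hpin₁' : ∃ u, dist (z₁ (S u)) (z₁ a₁) ≤ d₁)
    (hgap₁ : ∀ b₁, b₁ ≠ a₁ → dist (z₁ b₁) (z₁ a₁) < 13 / 10 * d₁ + g₁ → dist (z₁ b₁) (z₁ a₁) ≤ 13 / 10 * d₁ - g₁ ∧ ∃ u, S u = b₁)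
    (hM₁ : 20 * θ < d₁ - 2 * τ) (hM₂ : 23 / 5 * τ < g₁) (hM₃ : d₁ + 2 * τ ≤ 3 / 2)
    (hM₄ : dist (z₁ a₁) (z₁ c₁) + 2 * τ + (13 / 10 * (d₁ + 2 * τ) + g₁) ≤ 63 / 10) (hM₅ : 40 * τ ≤ d₁) : DeadRef z₁ c₁ τ 0 0 :=
  deadRef_of_tightWitness (by linarith) (by linarith) (tightWitness_of_fccShellFit hτ hSa hS₆ hθ hpin₁ hpin₁' hgap₁ hM₁ hM₂ hM₃ hM₄ hM₅)

/-- ★★ **DEAD-lo ⟹ DEAD cell from the INSTANCE LEAF** (hcp shell). [folklore] -/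
theorem deadRef_of_hcpShellFit (hτ : 0 ≤ τ) (hr : dist (z₁ a₁) (z₁ c₁) + 2 * τ ≤ 9 / 2) {S : ↥hcpKissingPattern → Fin M₁} {d₁ g₁ θ : ℝ}
    (hSa : ∀ u, S u ≠ a₁) (hS₆ : ∀ u, dist (z₁ (S u)) (z₁ c₁) ≤ 6)
    (hθ : ShellFit (fun u : ↥hcpKissingPattern => (u : E3)) (fun u => z₁ (S u)) (z₁ a₁) (2 * τ) θ)
    (hpin₁ : ∀ u, d₁ ≤ dist (z₁ (S u)) (z₁ a₁)) (hpin₁' : ∃ u, dist (z₁ (S u)) (z₁ a₁) ≤ d₁)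
    (hgap₁ : ∀ b₁, b₁ ≠ a₁ → dist (z₁ b₁) (z₁ a₁) < 13 / 10 * d₁ + g₁ → dist (z₁ b₁) (z₁ a₁) ≤ 13 / 10 * d₁ - g₁ ∧ ∃ u, S u = b₁)
    (hM₁ : 20 * θ < d₁ - 2 * τ) (hM₂ : 23 / 5 * τ < g₁) (hM₃ : d₁ + 2 * τ ≤ 3 / 2)
    (hM₄ : dist (z₁ a₁) (z₁ c₁) + 2 * τ + (13 / 10 * (d₁ + 2 * τ) + g₁) ≤ 63 / 10) (hM₅ : 40 * τ ≤ d₁) : DeadRef z₁ c₁ τ 0 0 :=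
  deadRef_of_tightWitness (by linarith) (by linarith) (tightWitness_of_hcpShellFit hτ hSa hS₆ hθ hpin₁ hpin₁' hgap₁ hM₁ hM₂ hM₃ hM₄ hM₅)

/-- ★★ **DEAD-lo CERTIFICATE from (K13), fcc reference shell** ⟹ `TightWitness z₁ c₁ τ 0 0 a₁`. [folklore] -/
theorem tightWitness_of_fccShell {c : ℝ} (hK : ShellRigid13 c) (hc : 0 ≤ c) (hτ : 0 ≤ τ)
    {S : ↥fccKissingPattern → Fin M₁} {d₁ η₁ g₁ : ℝ} {A₁ : E3 →ₗᵢ[ℝ] E3} (hSa : ∀ u, S u ≠ a₁) (hS₆ : ∀ u, dist (z₁ (S u)) (z₁ c₁) ≤ 6)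
    (hfit₁ : ∀ u, ‖(z₁ (S u) - z₁ a₁) - d₁ • A₁ (u : E3)‖ ≤ η₁ * d₁) (hη₁ : 0 ≤ η₁)
    (hpin₁ : ∀ u, d₁ ≤ dist (z₁ (S u)) (z₁ a₁)) (hpin₁' : ∃ u, dist (z₁ (S u)) (z₁ a₁) ≤ d₁)
    (hgap₁ : ∀ b₁, b₁ ≠ a₁ → dist (z₁ b₁) (z₁ a₁) < 13 / 10 * d₁ + g₁ → dist (z₁ b₁) (z₁ a₁) ≤ 13 / 10 * d₁ - g₁ ∧ ∃ u, S u = b₁)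
    (hM₁ : 20 * (η₁ * d₁ + c * (2 * τ)) < d₁ - 2 * τ) (hM₂ : 23 / 5 * τ < g₁) (hM₃ : d₁ + 2 * τ ≤ 3 / 2)
    (hM₄ : dist (z₁ a₁) (z₁ c₁) + 2 * τ + (13 / 10 * (d₁ + 2 * τ) + g₁) ≤ 63 / 10) (hM₅ : 40 * τ ≤ d₁) : TightWitness z₁ c₁ τ 0 0 a₁ :=
  fun _ _ _ _ hch _ ha hea =>
    goodAtScale_iff_fcc_or_hcp.2 (Or.inl (fit_twentieth_of_refShell hK.1 hc hτ hSa hS₆ hfit₁ hη₁ hpin₁ hpin₁' hgap₁ hM₁ hM₂ hM₃ hM₄ hM₅ hch ha hea))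

/-- ★★ **DEAD-lo CERTIFICATE from (K13), hcp reference shell** ⟹ `TightWitness z₁ c₁ τ 0 0 a₁`. [folklore] -/
theorem tightWitness_of_hcpShell {c : ℝ} (hK : ShellRigid13 c) (hc : 0 ≤ c) (hτ : 0 ≤ τ)
    {S : ↥hcpKissingPattern → Fin M₁} {d₁ η₁ g₁ : ℝ} {A₁ : E3 →ₗᵢ[ℝ] E3} (hSa : ∀ u, S u ≠ a₁) (hS₆ : ∀ u, dist (z₁ (S u)) (z₁ c₁) ≤ 6)
    (hfit₁ : ∀ u, ‖(z₁ (S u) - z₁ a₁) - d₁ • A₁ (u : E3)‖ ≤ η₁ * d₁) (hη₁ : 0 ≤ η₁)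
    (hpin₁ : ∀ u, d₁ ≤ dist (z₁ (S u)) (z₁ a₁)) (hpin₁' : ∃ u, dist (z₁ (S u)) (z₁ a₁) ≤ d₁)
    (hgap₁ : ∀ b₁, b₁ ≠ a₁ → dist (z₁ b₁) (z₁ a₁) < 13 / 10 * d₁ + g₁ → dist (z₁ b₁) (z₁ a₁) ≤ 13 / 10 * d₁ - g₁ ∧ ∃ u, S u = b₁)
    (hM₁ : 20 * (η₁ * d₁ + c * (2 * τ)) < d₁ - 2 * τ) (hM₂ : 23 / 5 * τ < g₁) (hM₃ : d₁ + 2 * τ ≤ 3 / 2)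
    (hM₄ : dist (z₁ a₁) (z₁ c₁) + 2 * τ + (13 / 10 * (d₁ + 2 * τ) + g₁) ≤ 63 / 10) (hM₅ : 40 * τ ≤ d₁) : TightWitness z₁ c₁ τ 0 0 a₁ :=
  fun _ _ _ _ hch _ ha hea =>
    goodAtScale_iff_fcc_or_hcp.2 (Or.inr (fit_twentieth_of_refShell hK.2 hc hτ hSa hS₆ hfit₁ hη₁ hpin₁ hpin₁' hgap₁ hM₁ hM₂ hM₃ hM₄ hM₅ hch ha hea))

/-- ★★ **DEAD-lo ⟹ DEAD cell from (K13)** (fcc shell; the site within `9/2 − 2τ` of the centre, T2). [folklore] -/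
theorem deadRef_of_fccShell {c : ℝ} (hK : ShellRigid13 c) (hc : 0 ≤ c) (hτ : 0 ≤ τ) (hr : dist (z₁ a₁) (z₁ c₁) + 2 * τ ≤ 9 / 2)
    {S : ↥fccKissingPattern → Fin M₁} {d₁ η₁ g₁ : ℝ} {A₁ : E3 →ₗᵢ[ℝ] E3} (hSa : ∀ u, S u ≠ a₁) (hS₆ : ∀ u, dist (z₁ (S u)) (z₁ c₁) ≤ 6)
    (hfit₁ : ∀ u, ‖(z₁ (S u) - z₁ a₁) - d₁ • A₁ (u : E3)‖ ≤ η₁ * d₁) (hη₁ : 0 ≤ η₁)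
    (hpin₁ : ∀ u, d₁ ≤ dist (z₁ (S u)) (z₁ a₁)) (hpin₁' : ∃ u, dist (z₁ (S u)) (z₁ a₁) ≤ d₁)
    (hgap₁ : ∀ b₁, b₁ ≠ a₁ → dist (z₁ b₁) (z₁ a₁) < 13 / 10 * d₁ + g₁ → dist (z₁ b₁) (z₁ a₁) ≤ 13 / 10 * d₁ - g₁ ∧ ∃ u, S u = b₁)
    (hM₁ : 20 * (η₁ * d₁ + c * (2 * τ)) < d₁ - 2 * τ) (hM₂ : 23 / 5 * τ < g₁) (hM₃ : d₁ + 2 * τ ≤ 3 / 2)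
    (hM₄ : dist (z₁ a₁) (z₁ c₁) + 2 * τ + (13 / 10 * (d₁ + 2 * τ) + g₁) ≤ 63 / 10) (hM₅ : 40 * τ ≤ d₁) : DeadRef z₁ c₁ τ 0 0 :=
  deadRef_of_tightWitness (by linarith) (by linarith)
    (tightWitness_of_fccShell hK hc hτ hSa hS₆ hfit₁ hη₁ hpin₁ hpin₁' hgap₁ hM₁ hM₂ hM₃ hM₄ hM₅)

/-- ★★ **DEAD-lo ⟹ DEAD cell from (K13)** (hcp shell). [folklore] -/
theorem deadRef_of_hcpShell {c : ℝ} (hK : ShellRigid13 c) (hc : 0 ≤ c) (hτ : 0 ≤ τ) (hr : dist (z₁ a₁) (z₁ c₁) + 2 * τ ≤ 9 / 2)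
    {S : ↥hcpKissingPattern → Fin M₁} {d₁ η₁ g₁ : ℝ} {A₁ : E3 →ₗᵢ[ℝ] E3} (hSa : ∀ u, S u ≠ a₁) (hS₆ : ∀ u, dist (z₁ (S u)) (z₁ c₁) ≤ 6)
    (hfit₁ : ∀ u, ‖(z₁ (S u) - z₁ a₁) - d₁ • A₁ (u : E3)‖ ≤ η₁ * d₁) (hη₁ : 0 ≤ η₁)
    (hpin₁ : ∀ u, d₁ ≤ dist (z₁ (S u)) (z₁ a₁)) (hpin₁' : ∃ u, dist (z₁ (S u)) (z₁ a₁) ≤ d₁)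
    (hgap₁ : ∀ b₁, b₁ ≠ a₁ → dist (z₁ b₁) (z₁ a₁) < 13 / 10 * d₁ + g₁ → dist (z₁ b₁) (z₁ a₁) ≤ 13 / 10 * d₁ - g₁ ∧ ∃ u, S u = b₁)
    (hM₁ : 20 * (η₁ * d₁ + c * (2 * τ)) < d₁ - 2 * τ) (hM₂ : 23 / 5 * τ < g₁) (hM₃ : d₁ + 2 * τ ≤ 3 / 2)
    (hM₄ : dist (z₁ a₁) (z₁ c₁) + 2 * τ + (13 / 10 * (d₁ + 2 * τ) + g₁) ≤ 63 / 10) (hM₅ : 40 * τ ≤ d₁) : DeadRef z₁ c₁ τ 0 0 :=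
  deadRef_of_tightWitness (by linarith) (by linarith)
    (tightWitness_of_hcpShell hK hc hτ hSa hS₆ hfit₁ hη₁ hpin₁ hpin₁' hgap₁ hM₁ hM₂ hM₃ hM₄ hM₅)

end Tight

/-! ## §4. The arithmetic of the two walls at the record tolerance `τ = 1/80` (kill criteria for the instrument) -/

/-- The tight margin (M1) caps the usable rigidity constant: `40 c τ < d₁ (1 − 20 η₁) − 2τ`. [formal bookkeeping] -/
theorem constant_lt_of_tight_margin {c η₁ d₁ τ : ℝ} (h : 20 * (η₁ * d₁ + c * (2 * τ)) < d₁ - 2 * τ) :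
    40 * τ * c < d₁ * (1 - 20 * η₁) - 2 * τ := by
  linarith

/-- ★ KILL CRITERION made exact: at `τ = 1/80` a dead-lo certificate at a site of reference scale `d₁` and reference misfit `η₁ ≥ 0` needs
`c < 2 d₁ (1 − 20 η₁) − 1/20`; in particular `c < 2 d₁ − 1/20` (perfect reference shell) — so `c ≥ 2 d₁ − 1/20` at every shell scale of the census
(`c ≥ 2.95` covers all `d₁ ≤ 3/2`; `c ≥ 2.15` covers `d₁ ≤ 1.1`) means NO dead-lo wall anywhere. [formal bookkeeping] -/
theorem constant_lt_of_tight_margin_record {c η₁ d₁ : ℝ} (hη₁ : 0 ≤ η₁) (hd₁ : 0 ≤ d₁)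
    (h : 20 * (η₁ * d₁ + c * (2 * (1 / 80 : ℝ))) < d₁ - 2 * (1 / 80 : ℝ)) : c < 2 * d₁ * (1 - 20 * η₁) - 1 / 20 ∧ c < 2 * d₁ - 1 / 20 := by
  constructor
  · linarith
  · nlinarith [mul_nonneg hη₁ hd₁]

/-- Conversely the margin (M1) at `τ = 1/80` HOLDS as soon as `c ≤ 2 d₁ (1 − 20 η₁) − 1/20 − s` for any slack `s > 0`… stated exactly: (M1) at `1/80` is
EQUIVALENT to `c < 2 d₁ (1 − 20 η₁) − 1/20`. [formal bookkeeping] -/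
theorem tight_margin_record_iff {c η₁ d₁ : ℝ} :
    20 * (η₁ * d₁ + c * (2 * (1 / 80 : ℝ))) < d₁ - 2 * (1 / 80 : ℝ) ↔ c < 2 * d₁ * (1 - 20 * η₁) - 1 / 20 := by
  constructor <;> intro h <;> linarith

/-- The loose wall (R12) at `τ = 1/80`: the count radius is `9/8·ρ₁ + 17/320`, i.e. a reference shell with FEWER than twelve other sites within
`1.125 ρ₁ + 0.053125` of `a₁` (`ρ₁` = distance to its nearest site of the `6`-ball; bond-length spread above `≈ 1.18` at `ρ₁ = 1`) is dead-hi. [formal bookkeeping] -/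
theorem loose_radius_record (ρ₁ : ℝ) : 9 / 8 * (ρ₁ + 2 * (1 / 80 : ℝ)) + 2 * (1 / 80 : ℝ) = 9 / 8 * ρ₁ + 17 / 320 := by
  ring

end Summit.AtomisticToContinuum.Crystallization.Theorems.FrustratedLawDichotomyStrainedPatchShellWitness

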